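import Mathlib
import HarnessLib
import Summits.ValiantsHypothesis.ValiantsHypothesis.Theorems.KPlusLogSqLawMixedGaugeFamilyDownwardTwoScale

/-!
# Route «KPlusLogSqLaw», `WeakLifting` (stmt-ValiantsHypothesis-19561) — mixed-gauge series: the TWO-SCALE FAMILY DOWNWARD LAW ON THE FULL
# CLOSED BAND — fast exponents `1 + π_l` with `π_l ∈ [0, 1]` (both endpoints: fast speed EQUAL to the scale, and EXACTLY twice it)

HONEST FRAMING.  Helper file (hand leafhand-val-kpluslogsqlaw-1 g15, 2026-08-31; `--supports stmt-ValiantsHypothesis-19561 --as helper`, zero crux /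
stub credit; nothing here is about `WeakLifting` / `TropicalB` in their windows, the registered stubs, the doors, `MatrixDescartes` (18050) or
VP ≠ VNP).  Positive companion of this hand's negative series (p835674 / p835727 / p835779: the two-class law `ζ ≤ n + 2m` fails at every tested
fast ratio `> 2`, Descartes-tight from `9/4` on).  Hand g14's two-scale family downward law `family_down_card_le_twoScale` (p835170) asks the fast
exponents `1 + π_l` to have `π_l ∈ (0,1)` OPEN — fast speeds STRICTLY inside a factor two — because its kernel for `Y^{1+π}` is a Gram integral that
diverges at `π = 1`.  At the endpoint the kernel is elementary: the divided difference of `Y²` is `K(t,t') = Y_t + Y_{t'}`, and the form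
`Σ_{t,t'} Q_t K(t,t') Q_{t'} = 2(Σ_t Q_t)(Σ_t Y_t Q_t)` VANISHES on `Σ_t Q_t = 0` (conditionally null), which is all the proof uses.

Likewise at `π = 0` (fast speed equal to the scale `β`) the kernel is `K ≡ 1`, whose form `(Σ_t Q_t)²` vanishes on the hyperplane.

* `family_down_card_le_twoScale_band` — the statement of p835170 / this hand's `…_closed` (p835812, `π_l ∈ (0,1]`) with `π_l ∈ [0, 1]`:
  verbatim g14's proof with the fast kernel defined by cases (`0 < π_l < 1`: the Gram-integral kernel of `…LoewnerCND`; `π_l = 1`: `Y_t + Y_{t'}`;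
  `π_l = 0`: `1`).
The sequel `…BiCoordBand` turns it into the law `ζ ≤ n + 2m` for `aᵢ < β ≤ b_l ≤ 2β`, i.e. (taking `β = min b`) for EVERY speed configuration with
`max a < min b` and `max b ≤ 2·min b` — the full closed factor-two band, no auxiliary scale; with the negative series (p835674/p835727/p835779)
this pins the located boundary of the two-class law at fast ratio exactly two (failure for EVERY ratio `> 2` is located, not proved).
[folklore linear algebra over the Loewner kernel (Löwner 1934 / Heinz 1951; Bhatia–Sano 2009 for the conditional sign of `y^r`)]
-/

set_option linter.dupNamespace false
set_option autoImplicit false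

namespace Summit.ValiantsHypothesis.ValiantsHypothesis.Theorems.KPlusLogSqLaw

namespace MixedGauge

open MeasureTheory Set Filter Real Matrix Finset
open scoped Topology BigOperators
open Summit.ValiantsHypothesis.ValiantsHypothesis.Theorems.KPlusLogSqLaw.TowerGraft.TwoSidedThree.Loewner

variable {n m : ℕ}

/-- **TWO-SCALE FAMILY DOWNWARD LAW, CLOSED BAND.**  Distinct positive nodes `Y_t`, slow exponents `pᵢ ∈ (0,1)`, fast exponents `1 + π_l` with
`π_l ∈ (0,1]`; a finite family `J` of vectors `(wⱼ, qⱼ) ∈ ℝⁿ × ℝᵐ` attached to nodes with (i) across DIFFERENT nodes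
`Σᵢ (Y_{t'}^{pᵢ} − Y_t^{pᵢ}) wⱼ(i)wⱼ'(i) = Σ_l (Y_{t'}·Y_{t'}^{π_l} − Y_t·Y_t^{π_l}) qⱼ(l)qⱼ'(l)`, (ii) DOWNWARD ON THE SPAN at each node
`Σᵢ pᵢY_t^{pᵢ−1}(Σ_{j at t} cⱼwⱼ(i))² ≤ Σ_l (1+π_l)Y_t^{π_l}(Σ_{j at t} cⱼqⱼ(l))²`, (iii) vanishing aggregates force `c = 0`.  Then `#J ≤ m`.
[folklore] -/
theorem family_down_card_le_twoScale_band {T : ℕ} {J : Type} [Fintype J] [DecidableEq J]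
    (p : Fin n → ℝ) (hp : ∀ i, p i ∈ Set.Ioo (0:ℝ) 1) (ρ : Fin m → ℝ) (hρ : ∀ l, ρ l ∈ Set.Icc (0:ℝ) 1)
    (Y : Fin T → ℝ) (hY : ∀ t, 0 < Y t) (hinj : Function.Injective Y) (root : J → Fin T)
    (w : J → (Fin n → ℝ)) (q : J → (Fin m → ℝ))
    (hid : ∀ j j', root j ≠ root j' →
      ∑ i, (Y (root j') ^ p i - Y (root j) ^ p i) * (w j i * w j' i)
        = ∑ l, (Y (root j') * Y (root j') ^ ρ l - Y (root j) * Y (root j) ^ ρ l) * (q j l * q j' l))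
    (hdown : ∀ (t : Fin T) (c : J → ℝ),
      ∑ i, p i * Y t ^ (p i - 1) * ((∑ j ∈ univ.filter (fun j => root j = t), c j • w j) i) ^ 2
        ≤ ∑ l, (1 + ρ l) * Y t ^ ρ l * ((∑ j ∈ univ.filter (fun j => root j = t), c j • q j) l) ^ 2)
    (hli : ∀ c : J → ℝ, (∀ t, ∑ j ∈ univ.filter (fun j => root j = t), c j • w j = 0) →
      (∀ t, ∑ j ∈ univ.filter (fun j => root j = t), c j • q j = 0) → c = 0) :
    Fintype.card J ≤ m := by
  classical
  by_contra hlt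
  push Not at hlt
  -- a dependency among the fast components
  let f : (J → ℝ) →ₗ[ℝ] (Fin m → ℝ) :=
    { toFun := fun d => ∑ j, d j • q j
      map_add' := by
        intro d d'
        simp only [Pi.add_apply, add_smul, Finset.sum_add_distrib]
      map_smul' := by
        intro r d
        simp only [Pi.smul_apply, smul_eq_mul, mul_smul, ← Finset.smul_sum, RingHom.id_apply] }
  have hker : LinearMap.ker f ≠ ⊥ := by
    apply LinearMap.ker_ne_bot_of_finrank_lt
    rw [Module.finrank_fintype_fun_eq_card, Module.finrank_fintype_fun_eq_card, Fintype.card_fin]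
    exact hlt
  obtain ⟨c, hcker, hc0⟩ := (Submodule.ne_bot_iff _).mp hker
  have hsumq : ∑ j, c j • q j = 0 := LinearMap.mem_ker.mp hcker
  -- per-node aggregates
  set W : Fin T → (Fin n → ℝ) := fun t => ∑ j ∈ univ.filter (fun j => root j = t), c j • w j with hWdef
  set Q : Fin T → (Fin m → ℝ) := fun t => ∑ j ∈ univ.filter (fun j => root j = t), c j • q j with hQdef
  have hQsum : ∑ t, Q t = 0 := by
    simp only [hQdef]
    rw [Finset.sum_fiberwise univ root (fun j => c j • q j)]
    exact hsumq
  have hQsum_l : ∀ l, ∑ t, Q t l = 0 := by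
    intro l
    have := congrFun hQsum l
    rwa [Finset.sum_apply] at this
  -- two-point identities for the aggregates
  have hidW : ∀ t t', t ≠ t' → ∑ i, (Y t' ^ p i - Y t ^ p i) * (W t i * W t' i)
      = ∑ l, (Y t' * Y t' ^ ρ l - Y t * Y t ^ ρ l) * (Q t l * Q t' l) := by
    intro t t' htt'
    have hL : ∑ i, (Y t' ^ p i - Y t ^ p i) * (W t i * W t' i)
        = ∑ j ∈ univ.filter (fun j => root j = t), ∑ j' ∈ univ.filter (fun j => root j = t'),
            c j * c j' * ∑ i, (Y t' ^ p i - Y t ^ p i) * (w j i * w j' i) := by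
      simp only [hWdef, Finset.sum_apply, Pi.smul_apply, smul_eq_mul]
      calc ∑ i, (Y t' ^ p i - Y t ^ p i) *
              ((∑ j ∈ univ.filter (fun j => root j = t), c j * w j i) * ∑ j' ∈ univ.filter (fun j => root j = t'), c j' * w j' i)
          = ∑ i, ∑ j ∈ univ.filter (fun j => root j = t), ∑ j' ∈ univ.filter (fun j => root j = t'),
              c j * c j' * ((Y t' ^ p i - Y t ^ p i) * (w j i * w j' i)) := by
            refine Finset.sum_congr rfl fun i _ => ?_
            rw [Finset.sum_mul_sum, Finset.mul_sum]
            refine Finset.sum_congr rfl fun j _ => ?_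
            rw [Finset.mul_sum]
            refine Finset.sum_congr rfl fun j' _ => ?_
            ring
        _ = _ := by
            rw [Finset.sum_comm]
            refine Finset.sum_congr rfl fun j _ => ?_
            rw [Finset.sum_comm]
            refine Finset.sum_congr rfl fun j' _ => ?_
            rw [Finset.mul_sum]
    have hR : ∑ l, (Y t' * Y t' ^ ρ l - Y t * Y t ^ ρ l) * (Q t l * Q t' l)
        = ∑ j ∈ univ.filter (fun j => root j = t), ∑ j' ∈ univ.filter (fun j => root j = t'),
            c j * c j' * ∑ l, (Y t' * Y t' ^ ρ l - Y t * Y t ^ ρ l) * (q j l * q j' l) := by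
      simp only [hQdef, Finset.sum_apply, Pi.smul_apply, smul_eq_mul]
      calc ∑ l, (Y t' * Y t' ^ ρ l - Y t * Y t ^ ρ l) *
              ((∑ j ∈ univ.filter (fun j => root j = t), c j * q j l) * ∑ j' ∈ univ.filter (fun j => root j = t'), c j' * q j' l)
          = ∑ l, ∑ j ∈ univ.filter (fun j => root j = t), ∑ j' ∈ univ.filter (fun j => root j = t'),
              c j * c j' * ((Y t' * Y t' ^ ρ l - Y t * Y t ^ ρ l) * (q j l * q j' l)) := by
            refine Finset.sum_congr rfl fun l _ => ?_
            rw [Finset.sum_mul_sum, Finset.mul_sum]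
            refine Finset.sum_congr rfl fun j _ => ?_
            rw [Finset.mul_sum]
            refine Finset.sum_congr rfl fun j' _ => ?_
            ring
        _ = _ := by
            rw [Finset.sum_comm]
            refine Finset.sum_congr rfl fun j _ => ?_
            rw [Finset.sum_comm]
            refine Finset.sum_congr rfl fun j' _ => ?_
            rw [Finset.mul_sum]
    rw [hL, hR]
    refine Finset.sum_congr rfl fun j hj => Finset.sum_congr rfl fun j' hj' => ?_
    have hrj : root j = t := (Finset.mem_filter.mp hj).2
    have hrj' : root j' = t' := (Finset.mem_filter.mp hj').2
    have hne : root j ≠ root j' := by rw [hrj, hrj']; exact htt'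
    have h := hid j j' hne
    rw [hrj, hrj'] at h
    rw [h]
  have hdownW : ∀ t, ∑ i, p i * Y t ^ (p i - 1) * (W t i) ^ 2 ≤ ∑ l, (1 + ρ l) * Y t ^ ρ l * (Q t l) ^ 2 := fun t => hdown t c
  -- the kernels: slow `L i` (normalised Loewner kernel of Y^{pᵢ}), fast `K l` (divided difference of Y^{1+π_l})
  set cS : Fin n → ℝ := fun i => ∫ x in Ioi 0, rpowIntegrand₀₁ (p i) x 1 with hcSdef
  have hcS : ∀ i, 0 < cS i := fun i => integral_rpowIntegrand₀₁_one_pos (hp i)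
  set L : Fin n → Fin T → Fin T → ℝ :=
    fun i t t' => (cS i)⁻¹ * ∫ x in Ioi 0, x ^ p i / ((x + Y t) * (x + Y t')) with hLdef
  have hLdiag : ∀ i t, L i t t = p i * Y t ^ (p i - 1) := by
    intro i t
    simp only [hLdef]
    rw [integral_kernel_diag (p i) (Y t) (hp i) (hY t), ← mul_assoc, inv_mul_cancel₀ (ne_of_gt (hcS i)), one_mul]
  have hLoffi : ∀ i t t', L i t t' * (Y t - Y t') = Y t ^ p i - Y t' ^ p i := by
    intro i t t'
    simp only [hLdef]
    rw [mul_assoc, integral_kernel_mul_sub (p i) (Y t) (Y t') (hp i) (hY t) (hY t'), ← mul_assoc,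
      inv_mul_cancel₀ (ne_of_gt (hcS i)), one_mul]
  -- fast kernels: for `0 < π_l < 1` the Gram-integral form of the divided difference of `Y^{1+π_l}` (…LoewnerCND); at the endpoints the
  -- elementary divided differences of `Y¹` (`K ≡ 1`) and `Y²` (`K(t,t') = Y_t + Y_{t'}`), both conditionally NULL.
  have hρ1 : ∀ l, ¬ ρ l < 1 → ρ l = 1 := fun l h => le_antisymm (hρ l).2 (not_lt.mp h)
  have hρ0 : ∀ l, ¬ 0 < ρ l → ρ l = 0 := fun l h => le_antisymm (not_lt.mp h) (hρ l).1
  set K : Fin m → Fin T → Fin T → ℝ := fun l t t' =>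
    if 0 < ρ l then
      (if ρ l < 1 then Y t' ^ ρ l + Y t * ((∫ x in Ioi 0, rpowIntegrand₀₁ (ρ l) x 1)⁻¹ * ∫ x in Ioi 0, x ^ ρ l / ((x + Y t) * (x + Y t')))
      else Y t + Y t')
    else 1 with hKdef
  have hKoff : ∀ l t t', K l t t' * (Y t - Y t') = Y t * Y t ^ ρ l - Y t' * Y t' ^ ρ l := by
    intro l t t'
    by_cases hpos : 0 < ρ l
    · by_cases hlt : ρ l < 1
      · simp only [hKdef, if_pos hpos, if_pos hlt]
        exact (loewner_succ_entries (ρ l) ⟨hpos, hlt⟩ Y hY t t').1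
      · simp only [hKdef, if_pos hpos, if_neg hlt]
        rw [hρ1 l hlt]
        simp only [Real.rpow_one]
        ring
    · simp only [hKdef, if_neg hpos, hρ0 l hpos, Real.rpow_zero]
      ring
  have hKdiag : ∀ l t, K l t t = (1 + ρ l) * Y t ^ ρ l := by
    intro l t
    by_cases hpos : 0 < ρ l
    · by_cases hlt : ρ l < 1
      · simp only [hKdef, if_pos hpos, if_pos hlt]
        exact (loewner_succ_entries (ρ l) ⟨hpos, hlt⟩ Y hY t t).2
      · simp only [hKdef, if_pos hpos, if_neg hlt]
        rw [hρ1 l hlt]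
        simp only [Real.rpow_one]
        ring
    · simp only [hKdef, if_neg hpos, hρ0 l hpos, Real.rpow_zero]
      ring
  -- the form Φ = Σ_l Σ_{t,t'} Q_{t,l} K_l Q_{t',l} is ≤ 0 (conditional negativity / nullity, columns of Q sum to zero)
  have hΦle : ∑ l, ∑ t, ∑ t', Q t l * K l t t' * Q t' l ≤ 0 := by
    refine Finset.sum_nonpos fun l _ => ?_
    by_cases hpos : 0 < ρ l
    · by_cases hlt : ρ l < 1
      · have h := loewner_succ_form_nonpos (ρ l) ⟨hpos, hlt⟩ Y (fun t => Q t l) hY (hQsum_l l)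
        simpa only [hKdef, if_pos hpos, if_pos hlt] using h
      · have hz : ∑ t, ∑ t', Q t l * K l t t' * Q t' l
            = (∑ t, Q t l * Y t) * (∑ t', Q t' l) + (∑ t, Q t l) * (∑ t', Y t' * Q t' l) := by
          simp only [hKdef, if_pos hpos, if_neg hlt]
          rw [Finset.sum_mul_sum, Finset.sum_mul_sum, ← Finset.sum_add_distrib]
          refine Finset.sum_congr rfl fun t _ => ?_
          rw [← Finset.sum_add_distrib]
          refine Finset.sum_congr rfl fun t' _ => ?_
          ring
        rw [hz, hQsum_l l, mul_zero, zero_mul, add_zero]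
    · have hz : ∑ t, ∑ t', Q t l * K l t t' * Q t' l = (∑ t, Q t l) * (∑ t', Q t' l) := by
        simp only [hKdef, if_neg hpos]
        rw [Finset.sum_mul_sum]
        refine Finset.sum_congr rfl fun t _ => Finset.sum_congr rfl fun t' _ => ?_
        ring
      rw [hz, hQsum_l l, mul_zero]
  -- and Φ = Σ_i W_iᵀ L_i W_i + Σ_t excess_t ≥ 0
  have hoff : ∀ t t', t ≠ t' → ∑ l, Q t l * K l t t' * Q t' l = ∑ i, W t i * L i t t' * W t' i := by
    intro t t' htt'
    have hne : Y t - Y t' ≠ 0 := sub_ne_zero.mpr (fun h => htt' (hinj h))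
    have h := hidW t t' htt'
    -- multiply both sides by (Y t − Y t')
    have h1 : (∑ l, Q t l * K l t t' * Q t' l) * (Y t - Y t') = ∑ l, (Y t * Y t ^ ρ l - Y t' * Y t' ^ ρ l) * (Q t l * Q t' l) := by
      rw [Finset.sum_mul]
      refine Finset.sum_congr rfl fun l _ => ?_
      rw [← hKoff l t t']; ring
    have h2 : (∑ i, W t i * L i t t' * W t' i) * (Y t - Y t') = ∑ i, (Y t ^ p i - Y t' ^ p i) * (W t i * W t' i) := by
      rw [Finset.sum_mul]
      refine Finset.sum_congr rfl fun i _ => ?_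
      rw [← hLoffi i t t']; ring
    have h3 : ∑ l, (Y t * Y t ^ ρ l - Y t' * Y t' ^ ρ l) * (Q t l * Q t' l) = ∑ i, (Y t ^ p i - Y t' ^ p i) * (W t i * W t' i) := by
      have hl' : ∑ l, (Y t * Y t ^ ρ l - Y t' * Y t' ^ ρ l) * (Q t l * Q t' l)
          = -∑ l, (Y t' * Y t' ^ ρ l - Y t * Y t ^ ρ l) * (Q t l * Q t' l) := by
        rw [← Finset.sum_neg_distrib]; refine Finset.sum_congr rfl fun l _ => ?_; ring
      have hi' : ∑ i, (Y t ^ p i - Y t' ^ p i) * (W t i * W t' i) = -∑ i, (Y t' ^ p i - Y t ^ p i) * (W t i * W t' i) := by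
        rw [← Finset.sum_neg_distrib]; refine Finset.sum_congr rfl fun i _ => ?_; ring
      rw [hl', hi', h]
    have h4 : (∑ l, Q t l * K l t t' * Q t' l) * (Y t - Y t') = (∑ i, W t i * L i t t' * W t' i) * (Y t - Y t') := by
      rw [h1, h2, h3]
    exact mul_right_cancel₀ hne h4
  have hdiagt : ∀ t, ∑ l, Q t l * K l t t * Q t l = ∑ i, W t i * L i t t * W t i
      + (∑ l, (1 + ρ l) * Y t ^ ρ l * (Q t l) ^ 2 - ∑ i, p i * Y t ^ (p i - 1) * (W t i) ^ 2) := by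
    intro t
    have h1 : ∑ l, Q t l * K l t t * Q t l = ∑ l, (1 + ρ l) * Y t ^ ρ l * (Q t l) ^ 2 := by
      refine Finset.sum_congr rfl fun l _ => ?_; rw [hKdiag]; ring
    have h2 : ∑ i, W t i * L i t t * W t i = ∑ i, p i * Y t ^ (p i - 1) * (W t i) ^ 2 := by
      refine Finset.sum_congr rfl fun i _ => ?_; rw [hLdiag]; ring
    rw [h1, h2]; ring
  have hΦeq : ∑ l, ∑ t, ∑ t', Q t l * K l t t' * Q t' l
      = (∑ i, ∑ t, ∑ t', W t i * L i t t' * W t' i)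
        + ∑ t, (∑ l, (1 + ρ l) * Y t ^ ρ l * (Q t l) ^ 2 - ∑ i, p i * Y t ^ (p i - 1) * (W t i) ^ 2) := by
    -- reorder to Σ_t Σ_t' (Σ_l …) and split diagonal / off-diagonal
    have hre1 : ∑ l, ∑ t, ∑ t', Q t l * K l t t' * Q t' l = ∑ t, ∑ t', ∑ l, Q t l * K l t t' * Q t' l := by
      rw [Finset.sum_comm]; refine Finset.sum_congr rfl fun t _ => ?_; rw [Finset.sum_comm]
    have hre2 : ∑ i, ∑ t, ∑ t', W t i * L i t t' * W t' i = ∑ t, ∑ t', ∑ i, W t i * L i t t' * W t' i := by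
      rw [Finset.sum_comm]; refine Finset.sum_congr rfl fun t _ => ?_; rw [Finset.sum_comm]
    rw [hre1, hre2, ← Finset.sum_add_distrib]
    refine Finset.sum_congr rfl fun t _ => ?_
    have hsplit : ∀ (g : Fin T → ℝ), ∑ t', g t' = g t + ∑ t' ∈ univ.erase t, g t' := by
      intro g; rw [← Finset.add_sum_erase _ _ (Finset.mem_univ t)]
    rw [hsplit (fun t' => ∑ l, Q t l * K l t t' * Q t' l), hsplit (fun t' => ∑ i, W t i * L i t t' * W t' i), hdiagt t]
    have hrest : ∑ t' ∈ univ.erase t, ∑ l, Q t l * K l t t' * Q t' l = ∑ t' ∈ univ.erase t, ∑ i, W t i * L i t t' * W t' i := by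
      refine Finset.sum_congr rfl fun t' ht' => ?_
      exact hoff t t' (Ne.symm (Finset.mem_erase.mp ht').1)
    rw [hrest]; ring
  have hLpos : ∀ i (x : Fin T → ℝ), x ≠ 0 → 0 < ∑ t, ∑ t', x t * L i t t' * x t' := by
    intro i x hx
    have h := loewnerForm_pos (p i) (hp i) Y x hY hinj hx
    have heq : ∑ t, ∑ t', x t * L i t t' * x t'
        = (cS i)⁻¹ * ∑ t, ∑ t', x t * (∫ s in Ioi 0, s ^ p i / ((s + Y t) * (s + Y t'))) * x t' := by
      rw [Finset.mul_sum]
      refine Finset.sum_congr rfl fun t _ => ?_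
      rw [Finset.mul_sum]
      refine Finset.sum_congr rfl fun t' _ => ?_
      simp only [hLdef]; ring
    rw [heq]
    exact mul_pos (inv_pos.mpr (hcS i)) h
  have hLnn : ∀ i (x : Fin T → ℝ), 0 ≤ ∑ t, ∑ t', x t * L i t t' * x t' := by
    intro i x
    by_cases hx : x = 0
    · subst hx; simp
    · exact le_of_lt (hLpos i x hx)
  have hKi : ∀ i, 0 ≤ ∑ t, ∑ t', W t i * L i t t' * W t' i := fun i => hLnn i (fun t => W t i)
  have hA : 0 ≤ ∑ i, ∑ t, ∑ t', W t i * L i t t' * W t' i := Finset.sum_nonneg fun i _ => hKi i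
  have hexcess : ∀ t, 0 ≤ ∑ l, (1 + ρ l) * Y t ^ ρ l * (Q t l) ^ 2 - ∑ i, p i * Y t ^ (p i - 1) * (W t i) ^ 2 :=
    fun t => by linarith [hdownW t]
  have hB : 0 ≤ ∑ t, (∑ l, (1 + ρ l) * Y t ^ ρ l * (Q t l) ^ 2 - ∑ i, p i * Y t ^ (p i - 1) * (W t i) ^ 2) :=
    Finset.sum_nonneg fun t _ => hexcess t
  rw [hΦeq] at hΦle
  have hA0 : ∑ i, ∑ t, ∑ t', W t i * L i t t' * W t' i = 0 := by linarith
  have hB0 : ∑ t, (∑ l, (1 + ρ l) * Y t ^ ρ l * (Q t l) ^ 2 - ∑ i, p i * Y t ^ (p i - 1) * (W t i) ^ 2) = 0 := by linarith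
  -- every aggregate W_t vanishes
  have hW0 : ∀ t, W t = 0 := by
    intro t
    funext i
    have hi0 := (Finset.sum_eq_zero_iff_of_nonneg fun i _ => hKi i).mp hA0 i (Finset.mem_univ _)
    by_contra hne
    have hci : (fun t => W t i) ≠ 0 := fun h => hne (congrFun h t)
    have := hLpos i (fun t => W t i) hci
    linarith
  -- then every aggregate Q_t vanishes
  have hQ0 : ∀ t, Q t = 0 := by
    intro t
    have hBt := (Finset.sum_eq_zero_iff_of_nonneg fun t _ => hexcess t).mp hB0 t (Finset.mem_univ _)
    have hWs : ∑ i, p i * Y t ^ (p i - 1) * (W t i) ^ 2 = 0 := by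
      refine Finset.sum_eq_zero fun i _ => ?_
      rw [hW0 t]; simp
    rw [hWs, sub_zero] at hBt
    have hterms : ∀ l, 0 ≤ (1 + ρ l) * Y t ^ ρ l * (Q t l) ^ 2 := by
      intro l
      have h1 : 0 < 1 + ρ l := by linarith [(hρ l).1]
      have h2 : 0 < Y t ^ ρ l := Real.rpow_pos_of_pos (hY t) _
      positivity
    funext l
    have hl := (Finset.sum_eq_zero_iff_of_nonneg fun l _ => hterms l).mp hBt l (Finset.mem_univ _)
    have h1 : 0 < 1 + ρ l := by linarith [(hρ l).1]
    have h2 : 0 < Y t ^ ρ l := Real.rpow_pos_of_pos (hY t) _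
    have : (Q t l) ^ 2 = 0 := by
      rcases mul_eq_zero.mp hl with h | h
      · exact absurd h (ne_of_gt (mul_pos h1 h2))
      · exact h
    simpa using this
  exact hc0 (hli c (fun t => hW0 t) (fun t => hQ0 t))

end MixedGauge

end Summit.ValiantsHypothesis.ValiantsHypothesis.Theorems.KPlusLogSqLaw
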